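import Literature.Analysis.FluidPDE.DriftDiffusionTypeIDriftOscillation
import HarnessLib

/-!
# THEOREM U at the Kramers (Gaussian) rate: an explicit barrier with `λ ≍ e^{−(C+2γ)²}`

Topic `Literature/Analysis/FluidPDE` (family `ns`).  The one-dimensional profile input of
`TypeIDrift.typeIDrift_twoPoint_oscillation_of_barrier` (the upgrade slot named in
`DriftDiffusionTypeIDriftBarrier`) is discharged here by the HARMONIC-SCALE profile
`k(ρ) = 1 + b ∫₀^ρ e^{σ²/16 − bσ} dσ`, `b = C/2 + γ` (`γ > 0` free): since
`4k″ + (2C − ρ/2)k′ = −4γ·b·e^{ρ²/16 − bρ}` EXACTLY, the profile inequality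
`4k″ + (2C − ρ/2)k′ + λk ≤ 0` holds on `(0, ∞)` with
`λ = λ_K(C,γ) := γ(C+2γ)e^{−(C+2γ)²}/(4(C+2γ+4))`, by three elementary
integral bounds (`∫₀^ρ ≤ 2/b` on `[0,8b]`, `≤ 2/b + (ρ−8b)e^{E(ρ)}` on `[8b,16b+16]`, Laplace bound
`≤ e^{E(ρ)}` beyond).  Consequence `TypeIDrift.typeIDrift_twoPoint_oscillation_kramers`: THEOREM U of
`pub/ns-exp-scalarLiouville/MAP.md` rev 2 §2 with the GAUSSIAN exponent — rate `λ_K(C,γ)`, e.g.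
`γ = 1/(2(C+1))` gives `λ ≥ e^{−C²−3}/(40(C+1)(C+5))`-order, i.e. the MAP's certified sharp
`λ₁(C) ≍ (C/2√π)e^{−C²}` (DATUM A-1, word «UNIVERSAL CONSTANT = GAUSSIAN») up to a polynomial factor —
versus the previous kernel rate `e^{−(C+1)(8C+4)}/(4(C+1))` of `typeIDrift_twoPoint_oscillation`.
The sharp constant itself is NOT claimed.
WHAT THIS IS NOT: a statement about the LINEAR model `(SL)` `∂ₜθ + b·∇θ = Δθ` only; nothing here proves or
refutes `stub_scalarLiouville`, `PoloidalLiouville` (stmt-NavierStokesRegularity-1222) or Navier–Stokes regularity.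
References: `pub/ns-exp-scalarLiouville/MAP.md` rev 2 §2, RESULTS.md Table 1 (J1 j311533);
[SereginSilvestreSverakZlatos2012] (Liouville theorems for critical drifts), [KochNadirashviliSereginSverak2009, Thm 5.2].
-/

noncomputable section

open Set Function Filter Metric Topology InnerProductSpace MeasureTheory
open scoped RealInnerProductSpace Laplacian Topology

namespace Literature.Analysis.FluidPDE

namespace TypeIDrift

/-! ### §6 The Kramers-order rate and the harmonic-scale profile -/

section Kramers

/-- The Kramers-order rate `λ_K(C,γ) = γ(C+2γ)e^{−(C+2γ)²}/(4(C+2γ+4))` is positive for `C ≥ 0`, `γ > 0`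
(`pub/ns-exp-scalarLiouville/MAP.md` rev 2 §2: the sharp rate is `λ₁(C) ≍ (C/2√π)e^{−C²}`; `λ_K` has the same
Gaussian exponent up to the free shift `2γ` and a polynomial factor). [folklore] -/
private theorem kramersRate_pos {C γ : ℝ} (hC : 0 ≤ C) (hγ : 0 < γ) :
    0 < γ * (C + 2 * γ) * Real.exp (-(C + 2 * γ) ^ 2) / (4 * (C + 2 * γ + 4)) := by
  have h1 : 0 < C + 2 * γ := by linarith
  have h2 : 0 < 4 * (C + 2 * γ + 4) := by linarith
  positivity

/-- **The harmonic-scale barrier profile (Kramers order).**  For `C ≥ 0`, `γ > 0`, `b = C/2 + γ`, the profile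
`k(ρ) = 1 + b∫₀^ρ e^{σ²/16 − bσ}dσ` satisfies the profile hypotheses of
`typeIDrift_twoPoint_oscillation_of_barrier` with `λ = λ_K(C,γ) = γ(C+2γ)e^{−(C+2γ)²}/(4(C+2γ+4))` and
`A = 1 + (C+2γ)·ρ̄·e^{ρ̄²/4}` (any real `ρ̄`): `k(0) = 1`, `k′ = b e^{ρ²/16−bρ} ≥ 0`,
`4k″ + (2C − ρ/2)k′ = −4γ b e^{ρ²/16−bρ}`, and `λ_K(1 + b∫₀^ρ) ≤ 4γ b e^{ρ²/16−bρ}` on `(0,∞)` by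
`∫₀^ρ ≤ 2/b` (`ρ ≤ 8b`), `∫₀^ρ ≤ 2/b + (ρ−8b)e^{ρ²/16−bρ}` (`ρ ≥ 8b`), `∫₀^ρ ≤ e^{ρ²/16−bρ}` (`ρ ≥ 16b+16`),
`e^{ρ²/16−bρ} ≥ e^{−4b²}`.
[cite: SereginSilvestreSverakZlatos2012, §2 (one-dimensional comparison profile for critical drifts; explicit-rate variant)] -/
theorem halfLineOUBarrier_kramers {C γ : ℝ} (ρbar : ℝ) (hC : 0 ≤ C) (hγ : 0 < γ) :
    ∃ k k' k'' : ℝ → ℝ, 0 < k 0 ∧ (∀ ρ, HasDerivAt k (k' ρ) ρ) ∧ (∀ ρ, HasDerivAt k' (k'' ρ) ρ) ∧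
      (∀ ρ, 0 ≤ ρ → k 0 ≤ k ρ) ∧ (∀ ρ, 0 < ρ → 0 ≤ k' ρ) ∧
      (∀ ρ, 0 < ρ → 4 * k'' ρ + (2 * C - ρ / 2) * k' ρ
        + (γ * (C + 2 * γ) * Real.exp (-(C + 2 * γ) ^ 2) / (4 * (C + 2 * γ + 4))) * k ρ ≤ 0) ∧
      (∀ ρ, 0 ≤ ρ → ρ ≤ 2 * ρbar →
        k ρ ≤ (1 + (C + 2 * γ) * ρbar * Real.exp (ρbar ^ 2 / 4)) * k 0) := by
  set b : ℝ := C / 2 + γ with hb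
  have hb0 : 0 < b := by rw [hb]; linarith
  have h2b : C + 2 * γ = 2 * b := by rw [hb]; ring
  -- the integrand `f = e^{E}`, `E(σ) = σ²/16 − bσ`, and its primitive `h`
  set f : ℝ → ℝ := fun σ => Real.exp (σ ^ 2 / 16 - b * σ) with hf
  set h : ℝ → ℝ := fun ρ => ∫ σ in (0 : ℝ)..ρ, f σ with hh
  have hfc : Continuous f := by rw [hf]; fun_prop
  have hf0 : ∀ σ, 0 < f σ := fun σ => Real.exp_pos _
  have hfi : ∀ a c : ℝ, IntervalIntegrable f volume a c := fun a c => hfc.intervalIntegrable a c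
  -- derivatives
  have hE : ∀ ρ, HasDerivAt (fun σ => σ ^ 2 / 16 - b * σ) (ρ / 8 - b) ρ := by
    intro ρ
    have h1 : HasDerivAt (fun σ => σ * σ / 16 - b * σ) ((1 * ρ + ρ * 1) / 16 - b * 1) ρ :=
      (((hasDerivAt_id' ρ).mul (hasDerivAt_id' ρ)).div_const 16).sub ((hasDerivAt_id' ρ).const_mul b)
    have h2 : (fun σ : ℝ => σ ^ 2 / 16 - b * σ) = fun σ => σ * σ / 16 - b * σ := by
      funext σ; ring
    rw [h2]
    exact h1.congr_deriv (by ring)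
  have hfd : ∀ ρ, HasDerivAt f (f ρ * (ρ / 8 - b)) ρ := fun ρ => by
    rw [hf]; exact (hE ρ).exp
  have hhd : ∀ ρ, HasDerivAt h (f ρ) ρ := fun ρ =>
    intervalIntegral.integral_hasDerivAt_right (hfi 0 ρ) (hfc.stronglyMeasurableAtFilter _ _)
      hfc.continuousAt
  have hh0 : h 0 = 0 := by rw [hh]; exact intervalIntegral.integral_same
  -- lower bounds on `f`
  have hfmin : ∀ ρ, Real.exp (-(4 * b ^ 2)) ≤ f ρ := by
    intro ρ; rw [hf]; apply Real.exp_le_exp.2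
    nlinarith [sq_nonneg (ρ / 4 - 2 * b)]
  have hfone : ∀ ρ, 16 * b ≤ ρ → 1 ≤ f ρ := by
    intro ρ hρ; rw [hf, ← Real.exp_zero]; apply Real.exp_le_exp.2
    nlinarith [hb0]
  -- (I1) `h ρ ≤ 2/b` for `0 ≤ ρ ≤ 8b`
  have hI1 : ∀ ρ, 0 ≤ ρ → ρ ≤ 8 * b → h ρ ≤ 2 / b := by
    intro ρ hρ0 hρ8
    let g : ℝ → ℝ := fun σ => Real.exp (-(b / 2) * σ)
    let G : ℝ → ℝ := fun σ => -(2 / b) * Real.exp (-(b / 2) * σ)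
    have hgc : Continuous g := by fun_prop
    have hGd : ∀ σ, HasDerivAt G (g σ) σ := by
      intro σ
      have h1 : HasDerivAt (fun σ => -(b / 2) * σ) (-(b / 2) * 1) σ :=
        (hasDerivAt_id' σ).const_mul (-(b / 2))
      have h2 := (h1.exp).const_mul (-(2 / b))
      refine h2.congr_deriv ?_
      show -(2 / b) * (Real.exp (-(b / 2) * σ) * (-(b / 2) * 1)) = Real.exp (-(b / 2) * σ)
      field_simp
    have hmono : h ρ ≤ ∫ σ in (0 : ℝ)..ρ, g σ := by
      rw [hh]
      apply intervalIntegral.integral_mono_on hρ0 (hfi 0 ρ) (hgc.intervalIntegrable 0 ρ)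
      intro σ hσ
      show Real.exp (σ ^ 2 / 16 - b * σ) ≤ Real.exp (-(b / 2) * σ)
      apply Real.exp_le_exp.2
      nlinarith [hσ.1, hσ.2, hb0]
    have hval : ∫ σ in (0 : ℝ)..ρ, g σ = G ρ - G 0 :=
      intervalIntegral.integral_eq_sub_of_hasDerivAt (fun σ _ => hGd σ) (hgc.intervalIntegrable 0 ρ)
    have hG0 : G 0 = -(2 / b) := by
      show -(2 / b) * Real.exp (-(b / 2) * 0) = -(2 / b)
      simp
    have hGρ : G ρ ≤ 0 := by
      show -(2 / b) * Real.exp (-(b / 2) * ρ) ≤ 0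
      have : 0 < Real.exp (-(b / 2) * ρ) := Real.exp_pos _
      have : 0 < 2 / b := by positivity
      nlinarith
    linarith
  -- (I2) `h ρ ≤ 2/b + (ρ − 8b) f ρ` for `ρ ≥ 8b`
  have hI2 : ∀ ρ, 8 * b ≤ ρ → h ρ ≤ 2 / b + (ρ - 8 * b) * f ρ := by
    intro ρ hρ
    have hsplit : h ρ = (∫ σ in (0 : ℝ)..(8 * b), f σ) + ∫ σ in (8 * b)..ρ, f σ := by
      rw [hh]; exact (intervalIntegral.integral_add_adjacent_intervals (hfi _ _) (hfi _ _)).symm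
    have h1 : (∫ σ in (0 : ℝ)..(8 * b), f σ) ≤ 2 / b := hI1 (8 * b) (by positivity) le_rfl
    have h2 : (∫ σ in (8 * b)..ρ, f σ) ≤ ∫ _ in (8 * b)..ρ, f ρ := by
      apply intervalIntegral.integral_mono_on hρ (hfi _ _) (continuous_const.intervalIntegrable _ _)
      intro σ hσ
      rw [hf]
      apply Real.exp_le_exp.2
      nlinarith [hσ.1, hσ.2, hb0]
    rw [intervalIntegral.integral_const, smul_eq_mul] at h2
    linarith
  -- (I3) Laplace bound `h ρ ≤ f ρ` for `ρ ≥ 16b + 16`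
  have hI3 : ∀ ρ, 16 * b + 16 ≤ ρ → h ρ ≤ f ρ := by
    intro ρ hρ
    have hρ0 : 0 ≤ ρ := by nlinarith [hb0]
    let g : ℝ → ℝ := fun σ => f ρ * Real.exp (σ - ρ)
    have hgc : Continuous g := by fun_prop
    have hGd : ∀ σ, HasDerivAt g (g σ) σ := by
      intro σ
      have h1 : HasDerivAt (fun σ => σ - ρ) 1 σ := (hasDerivAt_id' σ).sub_const ρ
      have h2 := (h1.exp).const_mul (f ρ)
      refine h2.congr_deriv ?_
      show f ρ * (Real.exp (σ - ρ) * 1) = f ρ * Real.exp (σ - ρ)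
      rw [mul_one]
    have hmono : h ρ ≤ ∫ σ in (0 : ℝ)..ρ, g σ := by
      rw [hh]
      apply intervalIntegral.integral_mono_on hρ0 (hfi 0 ρ) (hgc.intervalIntegrable 0 ρ)
      intro σ hσ
      show Real.exp (σ ^ 2 / 16 - b * σ) ≤ Real.exp (ρ ^ 2 / 16 - b * ρ) * Real.exp (σ - ρ)
      rw [← Real.exp_add]
      apply Real.exp_le_exp.2
      nlinarith [hσ.1, hσ.2, hb0]
    have hval : ∫ σ in (0 : ℝ)..ρ, g σ = g ρ - g 0 :=
      intervalIntegral.integral_eq_sub_of_hasDerivAt (fun σ _ => hGd σ) (hgc.intervalIntegrable 0 ρ)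
    have hgρ : g ρ = f ρ := by
      show f ρ * Real.exp (ρ - ρ) = f ρ
      simp
    have hg0 : 0 ≤ g 0 := mul_nonneg (hf0 ρ).le (Real.exp_pos _).le
    linarith
  -- (I4) `h ρ ≤ ρ e^{ρ²/16}` for `ρ ≥ 0`, and (I5) `0 ≤ h ρ`
  have hI4 : ∀ ρ, 0 ≤ ρ → h ρ ≤ ρ * Real.exp (ρ ^ 2 / 16) := by
    intro ρ hρ0
    have h2 : h ρ ≤ ∫ _ in (0 : ℝ)..ρ, Real.exp (ρ ^ 2 / 16) := by
      rw [hh]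
      apply intervalIntegral.integral_mono_on hρ0 (hfi _ _) (continuous_const.intervalIntegrable _ _)
      intro σ hσ
      rw [hf]
      apply Real.exp_le_exp.2
      nlinarith [hσ.1, hσ.2, hb0]
    rw [intervalIntegral.integral_const, smul_eq_mul, sub_zero] at h2
    exact h2
  have hI5 : ∀ ρ, 0 ≤ ρ → 0 ≤ h ρ := fun ρ hρ0 => by
    rw [hh]; exact intervalIntegral.integral_nonneg hρ0 fun σ _ => (hf0 σ).le
  -- the rate in terms of `b`, and the three scalar inequalities it satisfies
  set L : ℝ := γ * (C + 2 * γ) * Real.exp (-(C + 2 * γ) ^ 2) / (4 * (C + 2 * γ + 4)) with hLdef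
  have hL : L = γ * b * Real.exp (-(4 * b ^ 2)) / (4 * b + 8) := by
    rw [hLdef, h2b]
    have : (4 : ℝ) * (2 * b + 4) ≠ 0 := by positivity
    field_simp
    ring
  have hL0 : 0 ≤ L := by rw [hLdef]; exact (kramersRate_pos hC hγ).le
  set e0 : ℝ := Real.exp (-(4 * b ^ 2)) with he0
  have he00 : 0 < e0 := Real.exp_pos _
  have he01 : e0 ≤ 1 := by rw [he0]; apply Real.exp_le_one_iff.2; nlinarith
  have hden : 0 < 4 * b + 8 := by linarith
  have hL1 : 3 * L ≤ 2 * γ * b * e0 := by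
    rw [hL, div_eq_mul_inv]
    have hinv : (4 * b + 8)⁻¹ ≤ 2 / 3 := by
      rw [inv_eq_one_div, div_le_div_iff₀ hden (by norm_num)]; linarith
    have : 0 ≤ γ * b * e0 := by positivity
    nlinarith
  have hL2 : L * (8 * b + 16) ≤ 2 * γ := by
    rw [hL]
    have hbe : b * e0 ≤ 1 := by
      -- `b ≤ 1 + 4b² ≤ e^{4b²}`
      have h1 : 4 * b ^ 2 + 1 ≤ Real.exp (4 * b ^ 2) := Real.add_one_le_exp _
      have h2 : b ≤ 4 * b ^ 2 + 1 := by nlinarith [sq_nonneg (b - 1 / 8)]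
      have h3 : e0 * Real.exp (4 * b ^ 2) = 1 := by
        rw [he0, ← Real.exp_add]; simp
      nlinarith [he00, Real.exp_pos (4 * b ^ 2)]
    have : γ * b * e0 / (4 * b + 8) * (8 * b + 16) = 2 * γ * (b * e0) := by
      field_simp; ring
    rw [this]
    nlinarith
  have hL3 : L * (1 + b) ≤ 4 * γ * b := by
    rw [hL]
    have h1 : γ * b * e0 / (4 * b + 8) ≤ γ * b / (4 * b + 8) := by
      apply div_le_div_of_nonneg_right _ hden.le
      have : 0 ≤ γ * b := by positivity
      nlinarith
    have h2 : γ * b / (4 * b + 8) * (1 + b) ≤ γ * b := by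
      rw [div_mul_eq_mul_div, div_le_iff₀ hden]
      have : 0 ≤ γ * b := by positivity
      nlinarith
    have h3 : 0 ≤ 1 + b := by linarith
    have : 0 ≤ γ * b := by positivity
    nlinarith [mul_le_mul_of_nonneg_right h1 h3]
  ---------------------------------------------------------------- the witnesses
  refine ⟨fun ρ => 1 + b * h ρ, fun ρ => b * f ρ, fun ρ => b * (f ρ * (ρ / 8 - b)),
    ?_, ?_, ?_, ?_, ?_, ?_, ?_⟩
  · -- `k 0 = 1 > 0`
    simp only [hh0, mul_zero, add_zero]; exact one_pos
  · -- `k′`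
    intro ρ
    have := ((hhd ρ).const_mul b).const_add 1
    simpa using this
  · -- `k″`
    intro ρ
    exact (hfd ρ).const_mul b
  · -- monotone from `0`
    intro ρ hρ
    simp only [hh0, mul_zero, add_zero]
    have := hI5 ρ hρ
    nlinarith
  · -- `k′ ≥ 0`
    intro ρ _
    exact mul_nonneg hb0.le (hf0 ρ).le
  · -- the profile inequality, three regions
    intro ρ hρ
    beta_reduce
    have hid : 4 * (b * (f ρ * (ρ / 8 - b))) + (2 * C - ρ / 2) * (b * f ρ) = -(4 * γ * b * f ρ) := by
      rw [hb]; ring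
    rw [hid]
    have hfρ := hf0 ρ
    have hfm := hfmin ρ
    -- goal: `−4γ b f + L (1 + b h) ≤ 0`; abstract the integral `h ρ` and `f ρ` into atoms
    generalize hHρ : h ρ = Hρ at *
    generalize hFρ : f ρ = Fρ at *
    have hγb : 0 ≤ 2 * γ * b := by positivity
    have hA : 3 * L ≤ 2 * γ * b * Fρ := by
      have := mul_le_mul_of_nonneg_left hfm hγb
      linarith
    rcases le_or_gt ρ (8 * b) with h8 | h8
    · -- Region I: `b h ≤ 2`
      have hh1 : b * Hρ ≤ 2 := by
        have := mul_le_mul_of_nonneg_left (hI1 ρ hρ.le h8) hb0.le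
        rw [hHρ] at this
        calc b * Hρ ≤ b * (2 / b) := this
          _ = 2 := by field_simp
      have h1 : L * (b * Hρ) ≤ L * 2 := mul_le_mul_of_nonneg_left hh1 hL0
      have h2 : 0 ≤ 2 * γ * b * Fρ := mul_nonneg hγb hfρ.le
      linarith [h1, h2, hA]
    rcases le_or_gt ρ (16 * b + 16) with h16 | h16
    · -- Region II: `b h ≤ 2 + b (8b+16) f`
      have hbF : 0 ≤ b * Fρ := mul_nonneg hb0.le hfρ.le
      have hh2 : b * Hρ ≤ 2 + (8 * b + 16) * (b * Fρ) := by
        have hI := hI2 ρ h8.le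
        rw [hHρ, hFρ] at hI
        have hρ' : (ρ - 8 * b) * Fρ ≤ (8 * b + 16) * Fρ :=
          mul_le_mul_of_nonneg_right (by linarith) hfρ.le
        have := mul_le_mul_of_nonneg_left (hI.trans (by linarith : 2 / b + (ρ - 8 * b) * Fρ ≤
          2 / b + (8 * b + 16) * Fρ)) hb0.le
        calc b * Hρ ≤ b * (2 / b + (8 * b + 16) * Fρ) := this
          _ = 2 + (8 * b + 16) * (b * Fρ) := by field_simp
      have h1 : L * (b * Hρ) ≤ L * (2 + (8 * b + 16) * (b * Fρ)) := mul_le_mul_of_nonneg_left hh2 hL0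
      have hB : L * (8 * b + 16) * (b * Fρ) ≤ 2 * γ * (b * Fρ) :=
        mul_le_mul_of_nonneg_right hL2 hbF
      linarith [h1, hA, hB]
    · -- Region III: `h ≤ f`, `f ≥ 1`
      have hf1 : 1 ≤ Fρ := by rw [← hFρ]; exact hfone ρ (by linarith)
      have hh3 : b * Hρ ≤ b * Fρ := by
        have := mul_le_mul_of_nonneg_left (hI3 ρ h16.le) hb0.le
        rwa [hHρ, hFρ] at this
      have hsum : 1 + b * Hρ ≤ (1 + b) * Fρ := by linarith [hh3, hf1]
      have h1 : L * (1 + b * Hρ) ≤ L * ((1 + b) * Fρ) := mul_le_mul_of_nonneg_left hsum hL0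
      have h2 : L * (1 + b) * Fρ ≤ 4 * γ * b * Fρ := mul_le_mul_of_nonneg_right hL3 hfρ.le
      linarith [h1, h2]
  · -- `k ≤ A·k(0)` on `[0, 2ρ̄]`
    intro ρ hρ0 hρ2
    beta_reduce
    simp only [hh0, mul_zero, add_zero, mul_one]
    have hρbar : 0 ≤ ρbar := by linarith
    have h1 : h ρ ≤ ρ * Real.exp (ρ ^ 2 / 16) := hI4 ρ hρ0
    have h2 : ρ * Real.exp (ρ ^ 2 / 16) ≤ 2 * ρbar * Real.exp (ρbar ^ 2 / 4) := by
      apply mul_le_mul hρ2 _ (Real.exp_pos _).le (by positivity)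
      apply Real.exp_le_exp.2
      nlinarith
    have h3 : b * h ρ ≤ b * (2 * ρbar * Real.exp (ρbar ^ 2 / 4)) :=
      mul_le_mul_of_nonneg_left (h1.trans h2) hb0.le
    have h4 : b * (2 * ρbar * Real.exp (ρbar ^ 2 / 4)) = (C + 2 * γ) * ρbar * Real.exp (ρbar ^ 2 / 4) := by
      rw [h2b]; ring
    linarith

end Kramers

/-! ### §7 THEOREM U at the Kramers rate -/

section KramersTheorem

variable {E : Type*} [NormedAddCommGroup E] [InnerProductSpace ℝ E] [FiniteDimensional ℝ E]

/-- **THEOREM U at the Kramers (Gaussian) rate.**  Let `θ` be `C²` and bounded by `M` on `(t₀, 0) × E`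
(`E` any finite-dimensional real inner-product space), solving `∂ₜθ = Δθ − ⟪b, ∇θ⟫` with a drift of
Type-I size `‖b(t,x)‖ ≤ C/√(−t)`, `C ≥ 0` — no divergence condition, no regularity of `b`.  Then for every
`γ > 0`, `t₀ < t₁ ≤ t < 0`, any `ρ̄` and `‖x − y‖ ≤ 2ρ̄√(−t)`:
`|θ(t,x) − θ(t,y)| ≤ 2·M·(1 + (C+2γ)ρ̄e^{ρ̄²/4})·(t/t₁)^{λ_K(C,γ)}`,
`λ_K(C,γ) = γ(C+2γ)e^{−(C+2γ)²}/(4(C+2γ+4))` — the Gaussian exponent of the MAP's sharp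
`λ₁(C) ≍ (C/2√π)e^{−C²}` (certified-numeric, DATUM A-1), up to the shift `2γ` and a polynomial factor.
(`pub/ns-exp-scalarLiouville/MAP.md` rev 2 §2 THEOREM U; proof = `typeIDrift_twoPoint_oscillation_of_barrier`
+ `halfLineOUBarrier_kramers`.)
[cite: SereginSilvestreSverakZlatos2012, Thm 1.1 (Liouville / oscillation decay for critical drifts — Type-I-in-time variant, no divergence condition)]
[cite: KochNadirashviliSereginSverak2009, Thm 5.2 (the Type-I axisymmetric no-swirl case it models)] -/
theorem typeIDrift_twoPoint_oscillation_kramers {θ : ℝ → E → ℝ} {b : ℝ → E → E}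
    {t₀ C M ρbar γ : ℝ}
    (hθ : ContDiffOn ℝ 2 (uncurry θ) (Ioo t₀ 0 ×ˢ univ))
    (hM : ∀ t ∈ Ioo t₀ 0, ∀ x, |θ t x| ≤ M) (hC : 0 ≤ C) (hγ : 0 < γ)
    (hb : ∀ t ∈ Ioo t₀ 0, ∀ x, ‖b t x‖ ≤ C / Real.sqrt (-t))
    (heq : ∀ t ∈ Ioo t₀ 0, ∀ x,
      deriv (fun s => θ s x) t = (Δ (θ t)) x - ⟪b t x, gradient (θ t) x⟫) :
    ∀ t₁ t : ℝ, t₀ < t₁ → t₁ ≤ t → t < 0 → ∀ x y : E,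
      ‖x - y‖ ≤ 2 * ρbar * Real.sqrt (-t) →
        |θ t x - θ t y| ≤ 2 * M * (1 + (C + 2 * γ) * ρbar * Real.exp (ρbar ^ 2 / 4)) *
          (t / t₁) ^ (γ * (C + 2 * γ) * Real.exp (-(C + 2 * γ) ^ 2) / (4 * (C + 2 * γ + 4))) := by
  obtain ⟨k, k', k'', hk0, hk1, hk2, hkmono, hk'0, hkin, hkA⟩ := halfLineOUBarrier_kramers ρbar hC hγ
  exact typeIDrift_twoPoint_oscillation_of_barrier hθ hM hC hb heq hk0 hk1 hk2 hkmono hk'0 hkin hkA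
    (kramersRate_pos hC hγ).le

/-- **THEOREM U, Gaussian rate with `γ = ½`.**  Same hypotheses; `‖x − y‖ ≤ 2ρ̄√(−t)` gives
`|θ(t,x) − θ(t,y)| ≤ 2·M·(1 + (C+1)ρ̄e^{ρ̄²/4})·(t/t₁)^{λ}` with the closed-form rate
`λ = (C+1)e^{−(C+1)²}/(8(C+5))` (`= λ_K(C,½)`).
[cite: SereginSilvestreSverakZlatos2012, Thm 1.1 (Liouville / oscillation decay for critical drifts — Type-I-in-time variant, no divergence condition)] -/
theorem typeIDrift_twoPoint_oscillation_gaussRate {θ : ℝ → E → ℝ} {b : ℝ → E → E}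
    {t₀ C M ρbar : ℝ}
    (hθ : ContDiffOn ℝ 2 (uncurry θ) (Ioo t₀ 0 ×ˢ univ))
    (hM : ∀ t ∈ Ioo t₀ 0, ∀ x, |θ t x| ≤ M) (hC : 0 ≤ C)
    (hb : ∀ t ∈ Ioo t₀ 0, ∀ x, ‖b t x‖ ≤ C / Real.sqrt (-t))
    (heq : ∀ t ∈ Ioo t₀ 0, ∀ x,
      deriv (fun s => θ s x) t = (Δ (θ t)) x - ⟪b t x, gradient (θ t) x⟫) :
    ∀ t₁ t : ℝ, t₀ < t₁ → t₁ ≤ t → t < 0 → ∀ x y : E,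
      ‖x - y‖ ≤ 2 * ρbar * Real.sqrt (-t) →
        |θ t x - θ t y| ≤ 2 * M * (1 + (C + 1) * ρbar * Real.exp (ρbar ^ 2 / 4)) *
          (t / t₁) ^ ((C + 1) * Real.exp (-(C + 1) ^ 2) / (8 * (C + 5))) := by
  have h := typeIDrift_twoPoint_oscillation_kramers (ρbar := ρbar) (γ := 1 / 2) hθ hM hC (by norm_num) hb heq
  have hrate : (1 / 2 : ℝ) * (C + 2 * (1 / 2)) * Real.exp (-(C + 2 * (1 / 2)) ^ 2) / (4 * (C + 2 * (1 / 2) + 4))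
      = (C + 1) * Real.exp (-(C + 1) ^ 2) / (8 * (C + 5)) := by
    have h1 : C + 2 * (1 / 2 : ℝ) = C + 1 := by ring
    rw [h1]
    have : (8 : ℝ) * (C + 5) ≠ 0 := by
      have : 0 < C + 5 := by linarith
      positivity
    field_simp
    ring
  have hconst : C + 2 * (1 / 2 : ℝ) = C + 1 := by ring
  intro t₁ t ht₀ ht₁ ht x y hxy
  have := h t₁ t ht₀ ht₁ ht x y hxy
  rw [hrate, hconst] at this
  exact this

end KramersTheorem

end TypeIDrift

end Literature.Analysis.FluidPDE

end
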